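import Mathlib
import HarnessLib

/-!
# `NoHeavyLowerTail` (crux stmt-CriticalPhenomena-4575), antithetic vdBHK programme: the TYPED PRODUCT THEOREM
# ('legs are free') and its POINT BASE — `AK(H) ∧ RL(H) ⟹ (***)⁺⁺` is multiplicative

Support file (seat `prim-ineq-gen-7` gen 43; `--supports stmt-CriticalPhenomena-4575`).  Nothing is asserted about the crux; no `sorry`,
no definitions.  Memo: run/shared/lean/prim/prim-ineq-gen-7/FINDING-PRODUCT-g43.md §1–§3.

CONTEXT.  For a rooted tree `(T,v)` with colouring poset `F_v` (involution `ι`, route sets `K(ρ)`), the TYPED per-tree inequality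
  `(***)⁺⁺ :  t(a,a',b,b') + #{ρ : cert₁(ρ)} + #{ρ : cert₂(ρ)} ≥ 0`  for all up-sets `a,a',b,b'` of `F_v`,
  `t = Σ_ρ (a(ρ) − a'(ιρ))(b(ρ) − b'(ιρ))`, `cert₁(ρ) = [a ∩ K(ρ) ≠ ∅][ρ ∉ a'][ρ ∉ b][b' ∩ K(ρ) ≠ ∅]`, `cert₂(ρ) = [ρ ∉ a][a' ∩ K(ρ) ≠ ∅][b ∩ K(ρ) ≠ ∅][ρ ∉ b']`,
for every cycle-vertex tree implies `RAA(Q;t)` for unicyclic `Q` (gen 25 reduction + gen 42 typed reduction, cycle length `≥ 3`).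
For legs `T₁, T₂` glued at the root, `F_v(T₁ ∨ T₂) = F_v(T₁) × F_v(T₂) =: G × H` with the product order, `ι = ι_G × ι_H`,
`K(g,h) = K_G(g) × K_H(h)` (gen 39 §1; re-verified on raw posets for 11 pairs of trees, gen 43).  THIS FILE proves, for ABSTRACT finite
preorders `G, H`, any maps `ι_G`, `K_G`, an involution `ι_H` and route sets `K_H`:

* `AntitheticTypedProduct.typed_product` — if `H` satisfies the ANTIPODAL KLEITMAN inequality `AK(H)`
  (`Σ_h U(h)V(ι_H h) ≤ Σ_h U(h)V(h)` for up-sets `U, V`) and the ROUTING LEMMA `RL(H)` (`#(R ∩ D) ≤ #{h ∈ D : R ∩ K_H(h) ≠ ∅}` for every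
  up-set `R` and down-set `D`), and the typed value of `G` is `≥ 0` at every FIBRE quadruple `(a_h, a'_h, b_h, b'_h)` of an up-set quadruple
  `(a,a',b,b')` of `G × H`, then the typed value of `G × H` at `(a,a',b,b')` is `≥ 0`:  `(***)⁺⁺(T₁) ∧ AK ∧ RL(F_v(T₂)) ⟹ (***)⁺⁺(T₁ ∨ T₂)`.
  Proof = three lines: the quadratic part un-mixes fibrewise by `AK(H)` (the FOREIGN-CUBE computation of gen 25 §4, any AK factor); for each
  `g` and each certificate TYPE separately, the straight certificates `{h : cert_i^G(Y_h)(g)} = R ∩ D` inject into real certificates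
  `{h : cert_i^{G×H}(g,h)} ⊇ {h ∈ D : R ∩ K_H(h) ≠ ∅}` by `RL(H)` (typed counting is what lets the two types inject independently); sum.
* `AntitheticTypedProduct.typed_point` — the POINT BASE: with `G` = one point the hypothesis is the trivial one-point inequality, so
  `AK(H) ∧ RL(H) ⟹ (***)⁺⁺(H)` outright.
Consequences (memo §3): `RL` is multiplicative (`RL(H₁) ∧ RL(H₂) ⟹ RL(H₁ × H₂)`, pencil) and holds for every root-degree-1 tree with `≤ 5`
edges (exhaustive Hall-matching census), so `(***)⁺⁺` — hence `RAA/ULEX` for the corresponding unicyclic graphs — holds for every rooted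
tree all of whose branches at the root have `≤ 5` edges, and for `T₁ ∨ (such branches)` whenever `(***)⁺⁺(T₁)` is known.
-/

namespace Summit.CriticalPhenomena.PercolationContinuityZ3.Theorems

open Finset

namespace AntitheticTypedProduct

variable {G H : Type*} [Fintype G] [Fintype H] [DecidableEq G] [DecidableEq H] [Preorder G] [Preorder H]

omit [DecidableEq H] [Preorder H] in
/-- A sum of `0/1` indicators over a finite type is the cardinality of the filter. [folklore] -/
theorem sum_ind (p : H → Prop) [DecidablePred p] :
    (∑ h, (if p h then (1 : ℤ) else 0)) = (((univ : Finset H).filter p).card : ℤ) := by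
  rw [Finset.sum_boole]

omit [Fintype G] in
/-- **FIBREWISE UN-MIXING (quadratic part).**  For an involution `ι_H` with the antipodal Kleitman inequality on up-sets of `H`, and an
up-set quadruple `(a,a',b,b')` of `G × H` (product preorder), at every `g`:
`Σ_h (a(g,h) − a'(ι_G g, ι_H h))(b(g,h) − b'(ι_G g, ι_H h)) ≥ Σ_h (a(g,h) − a'(ι_G g, h))(b(g,h) − b'(ι_G g, h))`
(the crossed products dominate the straight ones; gen 25 §4 with an arbitrary AK factor). [this work] -/
theorem unmix_fibre (ιG : G → G) (ιH : H → H) (hι : Function.Involutive ιH)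
    (hAK : ∀ U V : Finset H, IsUpperSet (U : Set H) → IsUpperSet (V : Set H) →
      (∑ h, (if h ∈ U then (1 : ℤ) else 0) * (if ιH h ∈ V then (1 : ℤ) else 0))
        ≤ ∑ h, (if h ∈ U then (1 : ℤ) else 0) * (if h ∈ V then (1 : ℤ) else 0))
    (a a' b b' : Finset (G × H)) (ha : IsUpperSet (a : Set (G × H))) (ha' : IsUpperSet (a' : Set (G × H)))
    (hb : IsUpperSet (b : Set (G × H))) (hb' : IsUpperSet (b' : Set (G × H))) (g : G) :
    (∑ h, ((if (g, h) ∈ a then (1 : ℤ) else 0) - (if (ιG g, h) ∈ a' then (1 : ℤ) else 0))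
            * ((if (g, h) ∈ b then (1 : ℤ) else 0) - (if (ιG g, h) ∈ b' then (1 : ℤ) else 0)))
      ≤ ∑ h, ((if (g, h) ∈ a then (1 : ℤ) else 0) - (if (ιG g, ιH h) ∈ a' then (1 : ℤ) else 0))
            * ((if (g, h) ∈ b then (1 : ℤ) else 0) - (if (ιG g, ιH h) ∈ b' then (1 : ℤ) else 0)) := by
  -- fibres as finsets of H
  set Ua : Finset H := univ.filter (fun h => (g, h) ∈ a) with hUa
  set Ub : Finset H := univ.filter (fun h => (g, h) ∈ b) with hUb
  set Va' : Finset H := univ.filter (fun h => (ιG g, h) ∈ a') with hVa'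
  set Vb' : Finset H := univ.filter (fun h => (ιG g, h) ∈ b') with hVb'
  have up_of : ∀ (s : Finset (G × H)) (x : G), IsUpperSet (s : Set (G × H)) →
      IsUpperSet ((univ.filter (fun h => (x, h) ∈ s) : Finset H) : Set H) := by
    intro s x hs h h' hle hh
    simp only [Finset.coe_filter, Finset.mem_univ, true_and, Set.mem_setOf_eq] at hh ⊢
    exact hs (show (x, h) ≤ (x, h') from ⟨le_rfl, hle⟩) hh
  have hUa_up : IsUpperSet (Ua : Set H) := up_of a g ha
  have hUb_up : IsUpperSet (Ub : Set H) := up_of b g hb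
  have hVa'_up : IsUpperSet (Va' : Set H) := up_of a' (ιG g) ha'
  have hVb'_up : IsUpperSet (Vb' : Set H) := up_of b' (ιG g) hb'
  -- the two Kleitman steps
  have k1 := hAK Ua Vb' hUa_up hVb'_up
  have k2 := hAK Ub Va' hUb_up hVa'_up
  simp only [hUa, hUb, hVa', hVb', Finset.mem_filter, Finset.mem_univ, true_and] at k1 k2
  -- reindex the a'b' term by the involution
  have k3 : (∑ h, (if (ιG g, ιH h) ∈ a' then (1 : ℤ) else 0) * (if (ιG g, ιH h) ∈ b' then (1 : ℤ) else 0))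
      = ∑ h, (if (ιG g, h) ∈ a' then (1 : ℤ) else 0) * (if (ιG g, h) ∈ b' then (1 : ℤ) else 0) :=
    Equiv.sum_comp (Function.Involutive.toPerm ιH hι)
      (fun h => (if (ιG g, h) ∈ a' then (1 : ℤ) else 0) * (if (ιG g, h) ∈ b' then (1 : ℤ) else 0))
  -- pointwise algebra: straight − crossed = −(xw − xw') − (yz − y'z) + (yw − y'w')
  have halg : ∀ h : H,
      ((if (g, h) ∈ a then (1 : ℤ) else 0) - (if (ιG g, h) ∈ a' then (1 : ℤ) else 0))
            * ((if (g, h) ∈ b then (1 : ℤ) else 0) - (if (ιG g, h) ∈ b' then (1 : ℤ) else 0))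
        = ((if (g, h) ∈ a then (1 : ℤ) else 0) - (if (ιG g, ιH h) ∈ a' then (1 : ℤ) else 0))
            * ((if (g, h) ∈ b then (1 : ℤ) else 0) - (if (ιG g, ιH h) ∈ b' then (1 : ℤ) else 0))
          + ((if (g, h) ∈ a then (1 : ℤ) else 0) * (if (ιG g, ιH h) ∈ b' then (1 : ℤ) else 0)
              - (if (g, h) ∈ a then (1 : ℤ) else 0) * (if (ιG g, h) ∈ b' then (1 : ℤ) else 0))
          + ((if (g, h) ∈ b then (1 : ℤ) else 0) * (if (ιG g, ιH h) ∈ a' then (1 : ℤ) else 0)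
              - (if (g, h) ∈ b then (1 : ℤ) else 0) * (if (ιG g, h) ∈ a' then (1 : ℤ) else 0))
          + ((if (ιG g, h) ∈ a' then (1 : ℤ) else 0) * (if (ιG g, h) ∈ b' then (1 : ℤ) else 0)
              - (if (ιG g, ιH h) ∈ a' then (1 : ℤ) else 0) * (if (ιG g, ιH h) ∈ b' then (1 : ℤ) else 0)) := by
    intro h; ring
  rw [Finset.sum_congr rfl (fun h _ => halg h)]
  simp only [Finset.sum_add_distrib, Finset.sum_sub_distrib]
  linarith

omit [Fintype G] in
/-- **PER-TYPE CERTIFICATE INJECTION.**  With the routing lemma `RL(H)` for `K_H`: for an up-set quadruple of `G × H`, at every `g`, the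
number of `h` with a REAL type-1 certificate at `(g,h)` (routes through `K_G(g) × K_H(h)`, non-membership of `(g,h)` in the two member
sets) is at least the number of `h` whose straight fibre quadruple is type-1 certified at `g` (routes through `K_G(g)` in the fibre at
`h` itself).  Stated for one type with route sets `a, b'` and member sets `a', b`; type 2 is the same lemma with the roles exchanged.
[this work] -/
theorem inject_fibre (KG : G → Finset G) (KH : H → Finset H)
    (hRL : ∀ R D : Finset H, IsUpperSet (R : Set H) → IsLowerSet (D : Set H) →
      (R ∩ D).card ≤ (D.filter (fun h => (R ∩ KH h).Nonempty)).card)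
    (a a' b b' : Finset (G × H)) (ha : IsUpperSet (a : Set (G × H))) (ha' : IsUpperSet (a' : Set (G × H)))
    (hb : IsUpperSet (b : Set (G × H))) (hb' : IsUpperSet (b' : Set (G × H))) (g : G) :
    (∑ h, (if ((∃ g₁ ∈ KG g, (g₁, h) ∈ a) ∧ (g, h) ∉ a' ∧ (g, h) ∉ b ∧ (∃ g₁ ∈ KG g, (g₁, h) ∈ b'))
              then (1 : ℤ) else 0))
      ≤ ∑ h, (if ((∃ g₁ ∈ KG g, ∃ h₁ ∈ KH h, (g₁, h₁) ∈ a) ∧ (g, h) ∉ a' ∧ (g, h) ∉ b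
                  ∧ (∃ g₁ ∈ KG g, ∃ h₁ ∈ KH h, (g₁, h₁) ∈ b')) then (1 : ℤ) else 0) := by
  classical
  set R : Finset H := univ.filter (fun h => (∃ g₁ ∈ KG g, (g₁, h) ∈ a) ∧ (∃ g₁ ∈ KG g, (g₁, h) ∈ b')) with hR
  set D : Finset H := univ.filter (fun h => (g, h) ∉ a' ∧ (g, h) ∉ b) with hD
  have hRup : IsUpperSet (R : Set H) := by
    intro h h' hle hh
    simp only [hR, Finset.coe_filter, Finset.mem_univ, true_and, Set.mem_setOf_eq] at hh ⊢
    obtain ⟨⟨g₁, hg₁, hm₁⟩, ⟨g₂, hg₂, hm₂⟩⟩ := hh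
    exact ⟨⟨g₁, hg₁, ha (show (g₁, h) ≤ (g₁, h') from ⟨le_rfl, hle⟩) hm₁⟩,
      ⟨g₂, hg₂, hb' (show (g₂, h) ≤ (g₂, h') from ⟨le_rfl, hle⟩) hm₂⟩⟩
  have hDlow : IsLowerSet (D : Set H) := by
    intro h h' hle hh
    simp only [hD, Finset.coe_filter, Finset.mem_univ, true_and, Set.mem_setOf_eq] at hh ⊢
    exact ⟨fun hm => hh.1 (ha' (show (g, h') ≤ (g, h) from ⟨le_rfl, hle⟩) hm),
      fun hm => hh.2 (hb (show (g, h') ≤ (g, h) from ⟨le_rfl, hle⟩) hm)⟩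
  have key := hRL R D hRup hDlow
  rw [sum_ind, sum_ind]
  have e1 : (univ : Finset H).filter (fun h => (∃ g₁ ∈ KG g, (g₁, h) ∈ a) ∧ (g, h) ∉ a' ∧ (g, h) ∉ b
      ∧ (∃ g₁ ∈ KG g, (g₁, h) ∈ b')) = R ∩ D := by
    ext h
    simp only [hR, hD, Finset.mem_filter, Finset.mem_univ, true_and, Finset.mem_inter]
    tauto
  have e2 : D.filter (fun h => (R ∩ KH h).Nonempty) ⊆ (univ : Finset H).filter
      (fun h => (∃ g₁ ∈ KG g, ∃ h₁ ∈ KH h, (g₁, h₁) ∈ a) ∧ (g, h) ∉ a' ∧ (g, h) ∉ b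
        ∧ (∃ g₁ ∈ KG g, ∃ h₁ ∈ KH h, (g₁, h₁) ∈ b')) := by
    intro h hh
    simp only [hR, hD, Finset.mem_filter, Finset.mem_univ, true_and] at hh ⊢
    obtain ⟨⟨hna', hnb⟩, ⟨h₁, hh₁⟩⟩ := hh
    simp only [Finset.mem_inter, Finset.mem_filter, Finset.mem_univ, true_and] at hh₁
    obtain ⟨⟨⟨g₁, hg₁, hm₁⟩, ⟨g₂, hg₂, hm₂⟩⟩, hK⟩ := hh₁
    exact ⟨⟨g₁, hg₁, h₁, hK, hm₁⟩, hna', hnb, ⟨g₂, hg₂, h₁, hK, hm₂⟩⟩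
  rw [e1]
  exact_mod_cast key.trans (Finset.card_le_card e2)

/-- **TYPED PRODUCT THEOREM ('legs are free').**  `G, H` finite preorders; `ι_G, K_G` arbitrary; `ι_H` an involution with the antipodal
Kleitman inequality `AK(H)` on up-sets; `K_H` route sets with the ROUTING LEMMA `RL(H)`: `#(R ∩ D) ≤ #{h ∈ D : R ∩ K_H(h) ≠ ∅}` for all
up-sets `R`, down-sets `D`.  If `(a,a',b,b')` is an up-set quadruple of `G × H` whose every fibre quadruple has nonnegative typed
`G`-value (`(***)⁺⁺` of `G`, routes `K_G`), then its typed `G × H`-value (involution `ι_G × ι_H`, routes `K_G × K_H`) is nonnegative.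
For colouring posets: `(***)⁺⁺(T₁) ∧ RL(F_v(T₂)) ⟹ (***)⁺⁺(T₁ ∨ T₂)` (memo FINDING-PRODUCT-g43 §1). [this work] -/
theorem typed_product (ιG : G → G) (ιH : H → H) (hι : Function.Involutive ιH)
    (KG : G → Finset G) (KH : H → Finset H)
    (hAK : ∀ U V : Finset H, IsUpperSet (U : Set H) → IsUpperSet (V : Set H) →
      (∑ h, (if h ∈ U then (1 : ℤ) else 0) * (if ιH h ∈ V then (1 : ℤ) else 0))
        ≤ ∑ h, (if h ∈ U then (1 : ℤ) else 0) * (if h ∈ V then (1 : ℤ) else 0))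
    (hRL : ∀ R D : Finset H, IsUpperSet (R : Set H) → IsLowerSet (D : Set H) →
      (R ∩ D).card ≤ (D.filter (fun h => (R ∩ KH h).Nonempty)).card)
    (a a' b b' : Finset (G × H)) (ha : IsUpperSet (a : Set (G × H))) (ha' : IsUpperSet (a' : Set (G × H)))
    (hb : IsUpperSet (b : Set (G × H))) (hb' : IsUpperSet (b' : Set (G × H)))
    (hG : ∀ h : H, 0 ≤
      (∑ g, ((if (g, h) ∈ a then (1 : ℤ) else 0) - (if (ιG g, h) ∈ a' then (1 : ℤ) else 0))
              * ((if (g, h) ∈ b then (1 : ℤ) else 0) - (if (ιG g, h) ∈ b' then (1 : ℤ) else 0)))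
      + (∑ g, (if ((∃ g₁ ∈ KG g, (g₁, h) ∈ a) ∧ (g, h) ∉ a' ∧ (g, h) ∉ b ∧ (∃ g₁ ∈ KG g, (g₁, h) ∈ b'))
              then (1 : ℤ) else 0))
      + (∑ g, (if ((g, h) ∉ a ∧ (∃ g₁ ∈ KG g, (g₁, h) ∈ a') ∧ (∃ g₁ ∈ KG g, (g₁, h) ∈ b) ∧ (g, h) ∉ b')
              then (1 : ℤ) else 0))) :
    0 ≤ (∑ g, ∑ h, ((if (g, h) ∈ a then (1 : ℤ) else 0) - (if (ιG g, ιH h) ∈ a' then (1 : ℤ) else 0))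
              * ((if (g, h) ∈ b then (1 : ℤ) else 0) - (if (ιG g, ιH h) ∈ b' then (1 : ℤ) else 0)))
      + (∑ g, ∑ h, (if ((∃ g₁ ∈ KG g, ∃ h₁ ∈ KH h, (g₁, h₁) ∈ a) ∧ (g, h) ∉ a' ∧ (g, h) ∉ b
                      ∧ (∃ g₁ ∈ KG g, ∃ h₁ ∈ KH h, (g₁, h₁) ∈ b')) then (1 : ℤ) else 0))
      + (∑ g, ∑ h, (if ((g, h) ∉ a ∧ (∃ g₁ ∈ KG g, ∃ h₁ ∈ KH h, (g₁, h₁) ∈ a')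
                      ∧ (∃ g₁ ∈ KG g, ∃ h₁ ∈ KH h, (g₁, h₁) ∈ b) ∧ (g, h) ∉ b') then (1 : ℤ) else 0)) := by
  -- (1) quadratic part, fibrewise
  have h1 : ∀ g, (∑ h, ((if (g, h) ∈ a then (1 : ℤ) else 0) - (if (ιG g, h) ∈ a' then (1 : ℤ) else 0))
            * ((if (g, h) ∈ b then (1 : ℤ) else 0) - (if (ιG g, h) ∈ b' then (1 : ℤ) else 0)))
      ≤ ∑ h, ((if (g, h) ∈ a then (1 : ℤ) else 0) - (if (ιG g, ιH h) ∈ a' then (1 : ℤ) else 0))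
            * ((if (g, h) ∈ b then (1 : ℤ) else 0) - (if (ιG g, ιH h) ∈ b' then (1 : ℤ) else 0)) :=
    fun g => unmix_fibre ιG ιH hι hAK a a' b b' ha ha' hb hb' g
  -- (2) certificates, type 1 and type 2 (roles of (a,b') and (a',b) exchanged)
  have h2 : ∀ g, (∑ h, (if ((∃ g₁ ∈ KG g, (g₁, h) ∈ a) ∧ (g, h) ∉ a' ∧ (g, h) ∉ b ∧ (∃ g₁ ∈ KG g, (g₁, h) ∈ b'))
              then (1 : ℤ) else 0))
      ≤ ∑ h, (if ((∃ g₁ ∈ KG g, ∃ h₁ ∈ KH h, (g₁, h₁) ∈ a) ∧ (g, h) ∉ a' ∧ (g, h) ∉ b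
                  ∧ (∃ g₁ ∈ KG g, ∃ h₁ ∈ KH h, (g₁, h₁) ∈ b')) then (1 : ℤ) else 0) :=
    fun g => inject_fibre KG KH hRL a a' b b' ha ha' hb hb' g
  have h3 : ∀ g, (∑ h, (if ((g, h) ∉ a ∧ (∃ g₁ ∈ KG g, (g₁, h) ∈ a') ∧ (∃ g₁ ∈ KG g, (g₁, h) ∈ b) ∧ (g, h) ∉ b')
              then (1 : ℤ) else 0))
      ≤ ∑ h, (if ((g, h) ∉ a ∧ (∃ g₁ ∈ KG g, ∃ h₁ ∈ KH h, (g₁, h₁) ∈ a')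
                  ∧ (∃ g₁ ∈ KG g, ∃ h₁ ∈ KH h, (g₁, h₁) ∈ b) ∧ (g, h) ∉ b') then (1 : ℤ) else 0) := by
    intro g
    have h := inject_fibre KG KH hRL a' a b' b ha' ha hb' hb g
    have el : ∀ h : H, (((∃ g₁ ∈ KG g, (g₁, h) ∈ a') ∧ (g, h) ∉ a ∧ (g, h) ∉ b' ∧ (∃ g₁ ∈ KG g, (g₁, h) ∈ b))
        ↔ ((g, h) ∉ a ∧ (∃ g₁ ∈ KG g, (g₁, h) ∈ a') ∧ (∃ g₁ ∈ KG g, (g₁, h) ∈ b) ∧ (g, h) ∉ b')) :=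
      fun h => ⟨fun q => ⟨q.2.1, q.1, q.2.2.2, q.2.2.1⟩, fun q => ⟨q.2.1, q.1, q.2.2.2, q.2.2.1⟩⟩
    have er : ∀ h : H, (((∃ g₁ ∈ KG g, ∃ h₁ ∈ KH h, (g₁, h₁) ∈ a') ∧ (g, h) ∉ a ∧ (g, h) ∉ b'
          ∧ (∃ g₁ ∈ KG g, ∃ h₁ ∈ KH h, (g₁, h₁) ∈ b))
        ↔ ((g, h) ∉ a ∧ (∃ g₁ ∈ KG g, ∃ h₁ ∈ KH h, (g₁, h₁) ∈ a')
          ∧ (∃ g₁ ∈ KG g, ∃ h₁ ∈ KH h, (g₁, h₁) ∈ b) ∧ (g, h) ∉ b')) :=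
      fun h => ⟨fun q => ⟨q.2.1, q.1, q.2.2.2, q.2.2.1⟩, fun q => ⟨q.2.1, q.1, q.2.2.2, q.2.2.1⟩⟩
    simp only [el, er] at h
    exact h
  -- (3) assemble: swap the sums in the hypothesis and add
  have hsum : 0 ≤ ∑ g, ((∑ h, ((if (g, h) ∈ a then (1 : ℤ) else 0) - (if (ιG g, h) ∈ a' then (1 : ℤ) else 0))
              * ((if (g, h) ∈ b then (1 : ℤ) else 0) - (if (ιG g, h) ∈ b' then (1 : ℤ) else 0)))
      + (∑ h, (if ((∃ g₁ ∈ KG g, (g₁, h) ∈ a) ∧ (g, h) ∉ a' ∧ (g, h) ∉ b ∧ (∃ g₁ ∈ KG g, (g₁, h) ∈ b'))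
              then (1 : ℤ) else 0))
      + (∑ h, (if ((g, h) ∉ a ∧ (∃ g₁ ∈ KG g, (g₁, h) ∈ a') ∧ (∃ g₁ ∈ KG g, (g₁, h) ∈ b) ∧ (g, h) ∉ b')
              then (1 : ℤ) else 0))) := by
    have e : (∑ g, ((∑ h, ((if (g, h) ∈ a then (1 : ℤ) else 0) - (if (ιG g, h) ∈ a' then (1 : ℤ) else 0))
              * ((if (g, h) ∈ b then (1 : ℤ) else 0) - (if (ιG g, h) ∈ b' then (1 : ℤ) else 0)))
      + (∑ h, (if ((∃ g₁ ∈ KG g, (g₁, h) ∈ a) ∧ (g, h) ∉ a' ∧ (g, h) ∉ b ∧ (∃ g₁ ∈ KG g, (g₁, h) ∈ b'))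
              then (1 : ℤ) else 0))
      + (∑ h, (if ((g, h) ∉ a ∧ (∃ g₁ ∈ KG g, (g₁, h) ∈ a') ∧ (∃ g₁ ∈ KG g, (g₁, h) ∈ b) ∧ (g, h) ∉ b')
              then (1 : ℤ) else 0))))
      = ∑ h, ((∑ g, ((if (g, h) ∈ a then (1 : ℤ) else 0) - (if (ιG g, h) ∈ a' then (1 : ℤ) else 0))
              * ((if (g, h) ∈ b then (1 : ℤ) else 0) - (if (ιG g, h) ∈ b' then (1 : ℤ) else 0)))
      + (∑ g, (if ((∃ g₁ ∈ KG g, (g₁, h) ∈ a) ∧ (g, h) ∉ a' ∧ (g, h) ∉ b ∧ (∃ g₁ ∈ KG g, (g₁, h) ∈ b'))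
              then (1 : ℤ) else 0))
      + (∑ g, (if ((g, h) ∉ a ∧ (∃ g₁ ∈ KG g, (g₁, h) ∈ a') ∧ (∃ g₁ ∈ KG g, (g₁, h) ∈ b) ∧ (g, h) ∉ b')
              then (1 : ℤ) else 0))) := by
      simp only [Finset.sum_add_distrib]
      rw [Finset.sum_comm]
      congr 1
      congr 1
      · rw [Finset.sum_comm]
      · rw [Finset.sum_comm]
    rw [e]
    exact Finset.sum_nonneg (fun h _ => hG h)
  have t1 := Finset.sum_le_sum (fun g (_ : g ∈ (univ : Finset G)) => h1 g)
  have t2 := Finset.sum_le_sum (fun g (_ : g ∈ (univ : Finset G)) => h2 g)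
  have t3 := Finset.sum_le_sum (fun g (_ : g ∈ (univ : Finset G)) => h3 g)
  simp only [Finset.sum_add_distrib] at hsum
  linarith

/-- **POINT BASE.**  `AK(H) ∧ RL(H) ⟹ (***)⁺⁺(H)`: for an involution `ι_H` with the antipodal Kleitman inequality on up-sets and
route sets `K_H` with the routing lemma, the typed value `t(a,a',b,b') + #cert₁ + #cert₂` is nonnegative at every up-set quadruple of
`H` (route indicator `[s ∩ K_H(h) ≠ ∅]`).  (= `typed_product` with `G` a point, where the hypothesis is the one-point inequality
`(x − x')(y − y') + [x ∧ ¬x' ∧ ¬y ∧ y'] + [¬x ∧ x' ∧ y ∧ ¬y'] ≥ 0`.)  For colouring posets of rooted trees: `RL(F_v(T)) ⟹ (***)⁺⁺(T)`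
(memo FINDING-PRODUCT-g43 §2). [this work] -/
theorem typed_point (ιH : H → H) (hι : Function.Involutive ιH) (KH : H → Finset H)
    (hAK : ∀ U V : Finset H, IsUpperSet (U : Set H) → IsUpperSet (V : Set H) →
      (∑ h, (if h ∈ U then (1 : ℤ) else 0) * (if ιH h ∈ V then (1 : ℤ) else 0))
        ≤ ∑ h, (if h ∈ U then (1 : ℤ) else 0) * (if h ∈ V then (1 : ℤ) else 0))
    (hRL : ∀ R D : Finset H, IsUpperSet (R : Set H) → IsLowerSet (D : Set H) →
      (R ∩ D).card ≤ (D.filter (fun h => (R ∩ KH h).Nonempty)).card)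
    (A A' B B' : Finset H) (hA : IsUpperSet (A : Set H)) (hA' : IsUpperSet (A' : Set H))
    (hB : IsUpperSet (B : Set H)) (hB' : IsUpperSet (B' : Set H)) :
    0 ≤ (∑ h, ((if h ∈ A then (1 : ℤ) else 0) - (if ιH h ∈ A' then (1 : ℤ) else 0))
              * ((if h ∈ B then (1 : ℤ) else 0) - (if ιH h ∈ B' then (1 : ℤ) else 0)))
      + (∑ h, (if ((A ∩ KH h).Nonempty ∧ h ∉ A' ∧ h ∉ B ∧ (B' ∩ KH h).Nonempty) then (1 : ℤ) else 0))
      + (∑ h, (if (h ∉ A ∧ (A' ∩ KH h).Nonempty ∧ (B ∩ KH h).Nonempty ∧ h ∉ B') then (1 : ℤ) else 0)) := by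
  classical
  -- G := Unit; the quadruple on Unit × H
  let a : Finset (Unit × H) := A.map ⟨fun h => ((), h), fun x y hxy => by simpa using hxy⟩
  let a' : Finset (Unit × H) := A'.map ⟨fun h => ((), h), fun x y hxy => by simpa using hxy⟩
  let b : Finset (Unit × H) := B.map ⟨fun h => ((), h), fun x y hxy => by simpa using hxy⟩
  let b' : Finset (Unit × H) := B'.map ⟨fun h => ((), h), fun x y hxy => by simpa using hxy⟩
  have mem : ∀ (S : Finset H) (u : Unit) (h : H),
      ((u, h) ∈ (S.map ⟨fun h => ((), h), fun x y hxy => by simpa using hxy⟩ : Finset (Unit × H))) ↔ h ∈ S := by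
    intro S u h
    simp
  have up : ∀ (S : Finset H), IsUpperSet (S : Set H) →
      IsUpperSet ((S.map ⟨fun h => ((), h), fun x y hxy => by simpa using hxy⟩ : Finset (Unit × H)) : Set (Unit × H)) := by
    intro S hS p q hpq hp
    rcases p with ⟨u, h⟩; rcases q with ⟨u', h'⟩
    simp only [Finset.mem_coe] at hp ⊢
    rw [mem] at hp ⊢
    exact hS (Prod.mk_le_mk.mp hpq).2 hp
  have main := typed_product (G := Unit) (H := H) (fun _ => ()) ιH hι (fun _ => {()}) KH hAK hRL a a' b b'
    (up A hA) (up A' hA') (up B hB) (up B' hB') ?_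
  · -- translate the conclusion
    simp only [a, a', b, b', mem, Fintype.sum_unique, Finset.mem_singleton] at main
    have e1 : ∀ (S : Finset H) (h : H), (∃ h₁ ∈ KH h, h₁ ∈ S) ↔ (S ∩ KH h).Nonempty := by
      intro S h
      constructor
      · rintro ⟨h₁, hK, hS⟩; exact ⟨h₁, Finset.mem_inter.mpr ⟨hS, hK⟩⟩
      · rintro ⟨h₁, hh⟩; exact ⟨h₁, (Finset.mem_inter.mp hh).2, (Finset.mem_inter.mp hh).1⟩
    simp only [e1, true_and, exists_const] at main
    exact main
  · -- the one-point hypothesis: (x − x')(y − y') + [x ¬x' ¬y y'] + [¬x x' y ¬y'] ≥ 0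
    intro h
    simp only [a, a', b, b', mem, Fintype.sum_unique, Finset.mem_singleton]
    by_cases hx : h ∈ A <;> by_cases hx' : h ∈ A' <;> by_cases hy : h ∈ B <;> by_cases hy' : h ∈ B' <;>
      simp [hx, hx', hy, hy']

end AntitheticTypedProduct

end Summit.CriticalPhenomena.PercolationContinuityZ3.Theorems
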